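import Summits.SmoothPoincare4.SmoothPoincare4.Theorems.ConvexBisectionAcyclicBisectionRigidityStubUnfoldedSphereAux2
import Literature.Topology.FourManifolds.LefschetzHandlebody
import Literature.Topology.FourManifolds.CerfGammaFour
import Literature.Topology.FourManifolds.TwistedSpheres
import Literature.Topology.FourManifolds.MorseDiscLemma
import Literature.Topology.FourManifolds.SurgeryRegularDomain
import Literature.Topology.FourManifolds.EuclideanRegularDomainHessian
import Literature.Topology.FourManifolds.MorseExtrema
import Literature.Topology.FourManifolds.CorkDecomposition
import Literature.Topology.FourManifolds.HandleAttachingMapsUniqueness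
import HarnessLib

/-!
# Stub `stub_unfoldedSphere` of line `folded-curve-branch-locus` for crux
# `ConvexBisection.AcyclicBisectionRigidity` (stmt-SmoothPoincare4-10507): a genus-`0` fibred
# Lefschetz model with empty word is the 4-sphere (modulo Cerf's `Γ₄ = 0`)

Registered signature (lead a4, 2026-08-16): `cerf_twistedSphere_four → ∀ M, ModelsOnFibred M 0 [] →
M ≅ S⁴`.  Proof:

1. **`Base 0 ≅ D⁴`** (`helper_baseZero_diffeomorph_closedBall`, registered helper).  The Morse perturbation
   `fM ε` of `…Aux2.lean` is a Morse function on `ℝ⁴` (its Hessian at the unique critical point,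
   the centre, is `2(1 + ε)‖x_v‖² + 2ε‖y_v‖² > 0`, computed as a second derivative along lines:
   near the centre `fM ε (centre + tv) = (1 + ε)‖t² y_v² − t x_v‖² + ε‖t y_v‖²`), `1/4` is a
   regular level, `{fM ε ≤ 1/4} = {rho 0 ≤ 1/4}` is compact, and the adapted Morse function of
   `RegularSublevel.morseData` (Milnor 1963, Thm. 3.1) has one critical point, of index `0`; so
   `{fM ε ≤ 1/4} ≅ D⁴` by the tree's disc theorem `IsMorseAdapted.nonempty_diffeomorph_closedBall`,
   and `{fM ε ≤ 1/4} ≅ {rho 0 ≤ 1/4} = Base 0` along the identity of `ℝ⁴`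
   (`RegularSublevel.equivOfIsOpenRange`).
2. **`X ≅ Base 0`** for the handlebody `X` of a model with EMPTY word: a multi-attachment along an
   empty family is diffeomorphic to the base
   (`HandleAttachingMap.IsMultiAttachment.nonempty_diffeomorph_of_isEmpty`).
3. **Transport** of the gluing `M = X ∪_Ψ Base 0` along `D⁴ ≅ X` and `D⁴ ≅ Base 0`
   (`IsBoundaryGluing.transfer`, `IsBoundaryGluing.symm'`): `M = D⁴ ∪_φ D⁴` is a twisted sphere
   (`IsTwistedSphere 3 φ M`), hence `M ≅ S⁴` by the hypothesis `cerf_twistedSphere_four`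
   (Cerf 1968, `Γ₄ = 0`, tree named fact supplied by the neighbouring fact stub).

Everything is proved; no named facts are introduced, no `sorry`.
-/

noncomputable section

-- the prescribed namespace `Summit.<P>.<Sub>.…` duplicates `SmoothPoincare4` (P = Sub)
set_option linter.dupNamespace false

open scoped Manifold ContDiff Topology ContinuousMap ComplexConjugate
open Set Function
open Literature.Topology.FourManifolds Literature.Topology.FourManifolds.LefschetzBase

namespace Summit.SmoothPoincare4.SmoothPoincare4.Theorems.AcyclicBisectionRigidity.FoldedCurveBranchLocus

/-- Local notation: `𝔼 n = ℝⁿ` (model space). -/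
local notation "𝔼 " n:arg => EuclideanSpace ℝ (Fin n)

/-- Local notation: the round 4-sphere `S⁴ ⊂ ℝ⁵`. -/
local notation "𝕊⁴" => (Metric.sphere (0 : EuclideanSpace ℝ (Fin 5)) 1)

/-! ### The Hessian of the perturbation at the centre -/

/-- The model quartic `ψ(t) = (1 + ε) ‖t² a − t b‖² + ε ‖t c‖²` along a line through the centre,
as a real polynomial. [folklore] -/
theorem model_quartic_eq (ε : ℝ) (a b c : ℂ) (t : ℝ) :
    (1 + ε) * ‖((t ^ 2 : ℝ) : ℂ) * a - (t : ℂ) * b‖ ^ 2 + ε * ‖(t : ℂ) * c‖ ^ 2 =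
      (1 + ε) * ‖a‖ ^ 2 * t ^ 4 + (-(2 * (1 + ε) * (conj a * b).re)) * t ^ 3 +
        ((1 + ε) * ‖b‖ ^ 2 + ε * ‖c‖ ^ 2) * t ^ 2 := by
  simp only [Complex.sq_norm, Complex.normSq_apply, Complex.sub_re, Complex.sub_im, Complex.mul_re,
    Complex.mul_im, Complex.ofReal_re, Complex.ofReal_im, Complex.conj_re, Complex.conj_im]
  ring

/-- The second derivative at `0` of `A t⁴ + B t³ + C t²` is `2C`. [folklore] -/
theorem hasDerivAt_deriv_quartic (A B C : ℝ) :
    HasDerivAt (deriv fun t : ℝ => A * t ^ 4 + B * t ^ 3 + C * t ^ 2) (2 * C) 0 := by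
  have h1 : ∀ t : ℝ, HasDerivAt (fun t : ℝ => A * t ^ 4 + B * t ^ 3 + C * t ^ 2)
      (A * (4 * t ^ 3) + B * (3 * t ^ 2) + C * (2 * t)) t := fun t => by
    have h4 := (hasDerivAt_pow 4 t).const_mul A
    have h3 := (hasDerivAt_pow 3 t).const_mul B
    have h2 := (hasDerivAt_pow 2 t).const_mul C
    refine ((h4.add h3).add h2).congr_deriv ?_
    push_cast
    ring
  have hd : deriv (fun t : ℝ => A * t ^ 4 + B * t ^ 3 + C * t ^ 2) =
      fun t => A * (4 * t ^ 3) + B * (3 * t ^ 2) + C * (2 * t) := funext fun t => (h1 t).deriv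
  rw [hd]
  have h4 := (hasDerivAt_pow 3 (0 : ℝ)).const_mul (A * 4)
  have h3 := (hasDerivAt_pow 2 (0 : ℝ)).const_mul (B * 3)
  have h2 := (hasDerivAt_id (0 : ℝ)).const_mul (C * 2)
  have h := (h4.add h3).add h2
  have hfun : (fun t : ℝ => A * (4 * t ^ 3) + B * (3 * t ^ 2) + C * (2 * t)) =
      fun t => A * 4 * t ^ 3 + B * 3 * t ^ 2 + C * 2 * id t := by
    funext t; simp only [id]; ring
  rw [hfun]
  refine h.congr_deriv ?_
  push_cast
  ring

/-- **The perturbation along a line through the centre, near `t = 0`**: there `‖x‖² < 4`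
(so `eta = 0`) and `rho 0 ≤ 1/8` (so `baseCut = 1`), whence
`fM ε (centre + t v) = (1 + ε) ‖t² y_v² − t x_v‖² + ε ‖t y_v‖²`. [folklore] -/
theorem fM_line_centre_eventuallyEq (ε : ℝ) (v : 𝔼 4) :
    (fun t : ℝ => fM ε (centre + t • v)) =ᶠ[𝓝 0]
      fun t : ℝ => (1 + ε) * ‖((t ^ 2 : ℝ) : ℂ) * cy v ^ 2 - (t : ℂ) * cx v‖ ^ 2 +
        ε * ‖(t : ℂ) * cy v‖ ^ 2 := by
  have hc1 : Continuous fun t : ℝ => ‖cx (centre + t • v)‖ ^ 2 :=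
    ((contDiff_cx.continuous).comp (continuous_const.add (continuous_id.smul continuous_const))).norm.pow 2
  have hc2 : Continuous fun t : ℝ => rho 0 (centre + t • v) :=
    (contDiff_rho 0).continuous.comp (continuous_const.add (continuous_id.smul continuous_const))
  have h1 : ∀ᶠ t : ℝ in 𝓝 0, ‖cx (centre + t • v)‖ ^ 2 < 4 := by
    refine hc1.continuousAt.eventually_lt continuousAt_const ?_
    simp
  have h2 : ∀ᶠ t : ℝ in 𝓝 0, rho 0 (centre + t • v) < 1 / 8 := by
    refine hc2.continuousAt.eventually_lt continuousAt_const ?_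
    simp
  filter_upwards [h1, h2] with t ht1 ht2
  have hw : w 0 (centre + t • v) = ((t ^ 2 : ℝ) : ℂ) * cy v ^ 2 - (t : ℂ) * cx v := by
    rw [w_zero_eq, cy_add, cx_add, cy_smul, cx_smul, cx_centre, cy_centre]
    push_cast
    ring
  have hy : cy (centre + t • v) = (t : ℂ) * cy v := by
    rw [cy_add, cy_smul, cy_centre]; ring
  have hrho : rho 0 (centre + t • v) = ‖w 0 (centre + t • v)‖ ^ 2 := by
    rw [rho, eta_of_le ht1.le, add_zero]
  rw [fM, baseCut_of_le ht2.le, one_mul, sigma, hrho, hw, hy]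
  ring

/-- **The Hessian of the perturbation at the centre**:
`D²(fM ε)(centre)(v, v) = 2(1 + ε)‖x_v‖² + 2ε‖y_v‖²`. [folklore] -/
theorem fderiv_fderiv_fM_centre (ε : ℝ) (v : 𝔼 4) :
    fderiv ℝ (fderiv ℝ (fM ε)) centre v v = 2 * ((1 + ε) * ‖cx v‖ ^ 2 + ε * ‖cy v‖ ^ 2) := by
  have hA := hasDerivAt_deriv_line ((contDiff_fM ε).of_le (by norm_cast)) centre v
  have hB := hasDerivAt_deriv_quartic ((1 + ε) * ‖cy v ^ 2‖ ^ 2)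
    (-(2 * (1 + ε) * (conj (cy v ^ 2) * cx v).re)) ((1 + ε) * ‖cx v‖ ^ 2 + ε * ‖cy v‖ ^ 2)
  have heq : (fun t : ℝ => fM ε (centre + t • v)) =ᶠ[𝓝 0]
      fun t : ℝ => (1 + ε) * ‖cy v ^ 2‖ ^ 2 * t ^ 4 +
        (-(2 * (1 + ε) * (conj (cy v ^ 2) * cx v).re)) * t ^ 3 +
        ((1 + ε) * ‖cx v‖ ^ 2 + ε * ‖cy v‖ ^ 2) * t ^ 2 := by
    filter_upwards [fM_line_centre_eventuallyEq ε v] with t ht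
    rw [ht, model_quartic_eq]
  have hB' := hB.congr_of_eventuallyEq heq.deriv
  exact hA.unique hB'

/-- The Hessian at the centre is positive definite (`ε > 0`). [folklore] -/
theorem fderiv_fderiv_fM_centre_pos {ε : ℝ} (hε : 0 < ε) {v : 𝔼 4} (hv : v ≠ 0) :
    0 < fderiv ℝ (fderiv ℝ (fM ε)) centre v v := by
  rw [fderiv_fderiv_fM_centre]
  have h : cx v ≠ 0 ∨ cy v ≠ 0 := by
    by_contra h0
    push Not at h0
    apply hv
    rw [← mk_cx_cy v, h0.1, h0.2, mk_zero]
  rcases h with h | h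
  · have := norm_pos_iff.2 h
    have : 0 < ‖cx v‖ ^ 2 := by positivity
    nlinarith [sq_nonneg ‖cy v‖]
  · have := norm_pos_iff.2 h
    have : 0 < ‖cy v‖ ^ 2 := by positivity
    nlinarith [sq_nonneg ‖cx v‖]


/-! ### The perturbation is a Morse function with regular level `1/4` -/

/-- **`fM ε` is a Morse function on `ℝ⁴`** for admissible parameters: its only critical point is
the centre, where the Hessian is positive definite. [folklore] -/
theorem isMorse_fM {ε D : ℝ} (hε : 0 < ε) (hD : ∀ t, |deriv Real.smoothTransition t| ≤ D)
    (hεD : ε * (16 * D) * 5 ≤ 1 / 2) : IsMorse (𝓡 4) (fM ε) := by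
  refine ⟨contMDiff_iff_contDiff.2 (contDiff_fM ε), fun p hp => ?_⟩
  have hpc := eq_centre_of_isMCriticalPt hε hD hεD hp
  rw [hpc]
  have key : ∀ u w, mhessian (𝓡 4) (fM ε) centre u w = fderiv ℝ (fderiv ℝ (fM ε)) centre u w :=
    fun u w => IsRegularCompactDomain.mhessian_self_apply (m := 3) (fM ε) centre u w
  refine ⟨fun u hu => ?_, fun u hu => ?_⟩
  · by_contra h0
    have := fderiv_fderiv_fM_centre_pos hε h0
    rw [← key, hu u] at this
    exact lt_irrefl _ this
  · by_contra h0
    have := fderiv_fderiv_fM_centre_pos hε h0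
    rw [← key, hu u] at this
    exact lt_irrefl _ this

/-- The Morse index of `fM ε` at the centre is `0` (a minimum). [folklore] -/
theorem morseIndex_fM_centre {ε : ℝ} (hε : 0 ≤ ε) : morseIndex (𝓡 4) (fM ε) centre = 0 := by
  refine IsLocalMin.morseIndex_eq_zero
    ((contMDiff_iff_contDiff.2 ((contDiff_fM ε).of_le (by norm_cast))).contMDiffAt) ?_
  filter_upwards with q
  rw [fM_centre]
  exact fM_nonneg hε q

/-- **`1/4` is a regular level of `fM ε`** (the only critical value is `0`). [folklore] -/
theorem isRegularLevel_fM {ε D : ℝ} (hε : 0 < ε) (hD : ∀ t, |deriv Real.smoothTransition t| ≤ D)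
    (hεD : ε * (16 * D) * 5 ≤ 1 / 2) : IsRegularLevel (𝓡 4) (fM ε) (1 / 4) :=
  (isMorse_fM hε hD hεD).isRegularLevel fun z hz => by
    rw [eq_centre_of_isMCriticalPt hε hD hεD hz, fM_centre]; norm_num

/-! ### The base is a closed 4-ball -/

/-- **The sublevel set `{fM ε ≤ 1/4}` is diffeomorphic to the closed 4-ball** (Milnor's
Thm. 3.1 with the Lemma of Morse, `IsMorseAdapted.nonempty_diffeomorph_closedBall`, applied to
the adapted Morse function `fM ε|{fM ε ≤ 1/4} + 3/4` of `RegularSublevel.morseData`: its unique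
critical point is the centre, of index `0`; compactness from `{fM ε ≤ 1/4} = {rho 0 ≤ 1/4}`).
[cite: Milnor1963, Thm. 3.1 and proof of Thm. 4.1 (p. 25)] -/
theorem nonempty_diffeomorph_regularSublevel_fM_closedBall {ε D : ℝ} (hε : 0 < ε)
    (hD : ∀ t, |deriv Real.smoothTransition t| ≤ D) (h5 : ε * 5 ≤ 1 / 16)
    (hεD : ε * (16 * D) * 5 ≤ 1 / 2) :
    Nonempty (RegularSublevel (isRegularLevel_fM hε hD hεD) ≃ₘ⟮𝓡∂ 4, 𝓡∂ 4⟯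
      (Metric.closedBall (0 : 𝔼 4) 1)) := by
  have hM := isMorse_fM hε hD hεD
  have hr := isRegularLevel_fM hε hD hεD
  have hK : IsCompact ((fM ε) ⁻¹' Iic (1 / 4)) := by
    have he : (fM ε) ⁻¹' Iic (1 / 4) = rho 0 ⁻¹' Iic (1 / 4) := by
      ext p; exact fM_le_iff hε.le h5 p
    rw [he]; exact isCompact_rho_le 0
  haveI : CompactSpace (RegularSublevel hr) := isCompact_iff_compactSpace.1 hK
  obtain ⟨hFa, hFcrit, hFind⟩ := RegularSublevel.morseData hM hr
  set P : RegularSublevel hr := RegularSublevel.mk hr centre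
    (by show fM ε centre ≤ 1 / 4; rw [fM_centre]; norm_num) with hP
  have hPc := (hFcrit P).2 (isMCriticalPt_fM_centre hε.le)
  have huniq : ∀ x : RegularSublevel hr, IsMCriticalPt (𝓡∂ 4)
      (fun x : RegularSublevel hr => fM ε (RegularSublevel.incl hr x) + (1 - 1 / 4)) x → x = P := by
    intro x hx
    apply RegularSublevel.injective_incl hr
    rw [hP, RegularSublevel.incl_mk]
    exact eq_centre_of_isMCriticalPt hε hD hεD ((hFcrit x).1 hx)
  have h0 : morseIndex (𝓡∂ 4)
      (fun x : RegularSublevel hr => fM ε (RegularSublevel.incl hr x) + (1 - 1 / 4)) P = 0 :=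
    (hFind P (isMCriticalPt_fM_centre hε.le)).trans (morseIndex_fM_centre hε.le)
  exact hFa.nonempty_diffeomorph_closedBall (k := 3) (by norm_num) hPc huniq h0

/-- **Registered helper `helper_baseZero_diffeomorph_closedBall` — the genus-`0` Lefschetz base
is a closed 4-ball**: `Base 0 ≅ 𝔻⁴`.  The two regular sublevel sets `{rho 0 ≤ 1/4}` and
`{fM ε ≤ 1/4}` of `ℝ⁴` have the same carrier, hence are diffeomorphic
(`RegularSublevel.equivOfIsOpenRange` along the identity), and the latter is a ball
(`nonempty_diffeomorph_regularSublevel_fM_closedBall`).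
[cite: Milnor1963, Thm. 3.1 and proof of Thm. 4.1 (p. 25)] -/
theorem helper_baseZero_diffeomorph_closedBall : Nonempty (Literature.Topology.FourManifolds.LefschetzBase.Base 0 ≃ₘ⟮𝓡∂ 4, 𝓡∂ 4⟯ (Metric.closedBall (0 : EuclideanSpace ℝ (Fin 4)) 1)) := by
  obtain ⟨ε, D, hε, hD, h5, hεD⟩ := exists_admissible
  obtain ⟨Ψ⟩ := nonempty_diffeomorph_regularSublevel_fM_closedBall hε hD h5 hεD
  let Φ := RegularSublevel.equivOfIsOpenRange (isRegularLevel_fM hε hD hεD) (isRegularLevel_rho 0) id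
    Manifold.IsSmoothEmbedding.id (by simp) (fun x => (fM_le_iff hε.le h5 x).symm) (by simp)
  exact ⟨Φ.symm.trans Ψ⟩

/-! ### From the ball to the twisted sphere, and the stub -/

/-- **A genus-`0` fibred Lefschetz model with empty word is a twisted sphere.**  Unfold
`ModelsOnFibred M 0 []` to `M = X ∪_Ψ Base 0` with `X` a multi-attachment of NO handles to
`Base 0`; then `X ≅ Base 0 ≅ D⁴`, and transporting the gluing along the two diffeomorphisms
(`IsBoundaryGluing.transfer` twice, `IsBoundaryGluing.symm'` in between) presents `M` as
`D⁴ ∪_φ D⁴`. [cite: KervaireMilnor1963, §1] -/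
theorem isTwistedSphere_of_modelsOnFibred_zero
    (M : Type) [TopologicalSpace M] [ChartedSpace (𝔼 4) M]
    (hM : ModelsOnFibred M 0 ([] : List ((Fin 0 ⊕ Fin 0 → ℤ) × Bool))) :
    ∃ φ : (Metric.sphere (0 : 𝔼 4) 1) ≃ₘ⟮𝓡 3, 𝓡 3⟯ (Metric.sphere (0 : 𝔼 4) 1),
      IsTwistedSphere 3 φ M := by
  obtain ⟨X, _, _, _, _, _, _, h, D, bX, Ψ, -, hglue, -⟩ := hM
  obtain ⟨eB⟩ := helper_baseZero_diffeomorph_closedBall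
  haveI : IsEmpty (Fin ([] : List ((Fin 0 ⊕ Fin 0 → ℤ) × Bool)).length) := Fin.isEmpty'
  -- `X ≅ Base 0`: no handles are attached
  obtain ⟨eX⟩ := D.isMultiAttachment.nonempty_diffeomorph_of_isEmpty
  -- `D⁴ ≅ X`, transport of the left piece
  set g₁ : (Metric.closedBall (0 : 𝔼 4) 1) ≃ₘ⟮𝓡∂ 4, 𝓡∂ 4⟯ X := (eX.trans eB).symm with hg₁
  have h1 := hglue.transfer (b₁ := closedBallBoundaryData 3) g₁
  have h1' : IsBoundaryGluing (closedBallBoundaryData 3) (bBase 0)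
      ⇑(((closedBallBoundaryData 3).restrictDiffeomorph bX g₁).trans Ψ) (𝓡 4) M := by
    rw [Diffeomorph.coe_trans]; exact h1
  -- swap the pieces and transport the cap `Base 0 ≅ D⁴`
  have h2 := h1'.symm'
  have h3 := h2.transfer (b₁ := closedBallBoundaryData 3) eB.symm
  have h3' : IsBoundaryGluing (closedBallBoundaryData 3) (closedBallBoundaryData 3)
      ⇑(((closedBallBoundaryData 3).restrictDiffeomorph (bBase 0) eB.symm).trans
        (((closedBallBoundaryData 3).restrictDiffeomorph bX g₁).trans Ψ).symm) (𝓡 4) M := by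
    rw [Diffeomorph.coe_trans]; exact h3
  exact ⟨_, h3'⟩

/-- **Stub C — THE UNFOLDED SPHERE** (registered signature, line `folded-curve-branch-locus`,
crux `ConvexBisection.AcyclicBisectionRigidity`, stmt-SmoothPoincare4-10507): a Hausdorff
second-countable `C^∞` 4-manifold with a genus-`0` fibred Lefschetz model of EMPTY word is
diffeomorphic to `S⁴`, granted Cerf's `Γ₄ = 0` in twisted-sphere form (`cerf_twistedSphere_four`,
taken as the first hypothesis): `M = X ∪_Ψ Base 0 = D⁴ ∪_φ D⁴` is a twisted sphere
(`isTwistedSphere_of_modelsOnFibred_zero`: `Base 0 ≅ D⁴` by Morse theory, `X ≅ Base 0` since no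
handle is attached), compact as a gluing of two compact pieces, so Cerf applies to the bundled
`TwistedSphere 3 φ` with carrier `M`. [cite: Cerf1968, main theorem (Γ₄ = 0)] -/
theorem stub_unfoldedSphere :
    Literature.Topology.FourManifolds.cerf_twistedSphere_four →
    ∀ (M : Type) [TopologicalSpace M] [T2Space M] [SecondCountableTopology M]
      [ChartedSpace (𝔼 4) M] [IsManifold (𝓡 4) ∞ M],
      ModelsOnFibred M 0 ([] : List ((Fin 0 ⊕ Fin 0 → ℤ) × Bool)) →
      Nonempty (M ≃ₘ⟮𝓡 4, 𝓡 4⟯ 𝕊⁴) := by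
  intro hcerf M _ _ _ _ _ hM
  haveI : CompactSpace M := hM.modelsOn.compactSpace
  obtain ⟨φ, hφ⟩ := isTwistedSphere_of_modelsOnFibred_zero M hM
  exact hcerf φ ⟨M, hφ⟩

end Summit.SmoothPoincare4.SmoothPoincare4.Theorems.AcyclicBisectionRigidity.FoldedCurveBranchLocus

end
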